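import Mathlib
import Literature.Probability.LatticeModels.BoxSineHarmonic
import Literature.Analysis.Matrix.KroneckerSumExp
import Literature.Analysis.Matrix.SigmaMinWitnessBounds
import HarnessLib

/-!
# Sine modes of the Dirichlet second-difference matrix and of its Kronecker sum: every rigorous σ-floor of `L − s·1` is at most `|λ_a + λ_b − s|`

Topic `Literature/Analysis/Matrix`; support file (all proved; no definitions; no named facts; plumbing lemmas are `private`).

The `m × m` second-difference (1-D Dirichlet Laplacian, tridiagonal Toeplitz `tridiag(−1, 2, −1)`) matrix `T` has the
SINE MODES `e_k(i) = sin(k (i+1) π/(m+1))`, `i = 0 … m−1`, with `T e_k = (2 − 2 cos(kπ/(m+1))) e_k` for every `k ∈ ℕ`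
(for `1 ≤ k ≤ m` the mode is non-zero) — the `δ = 2`, `σ = τ = −1` case of the classical tridiagonal-Toeplitz eigenpairs
[cite: NoscheseReichel2019, §1 eq. (2)–(3) (λ_h = δ + 2√(στ) cos(hπ/(n+1)), x_{h,k} = (σ/τ)^{k/2} sin(hkπ/(n+1)))].
Consequently the Kronecker sum `L = T ⊕ T = T ⊗ 1 + 1 ⊗ T` (the 2-D five-point Dirichlet Laplacian on an `m × m` grid,
`Literature.Analysis.Matrix.KroneckerSum.kroneckerSum`) has the separable modes `e_a ⊗ e_b` with
`L (e_a ⊗ e_b) = (λ_a + λ_b) (e_a ⊗ e_b)`, and for any shift `s` the vector `e_a ⊗ e_b` witnesses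
`‖(L − s·1)(e_a ⊗ e_b)‖₂ / ‖e_a ⊗ e_b‖₂ = |λ_a + λ_b − s|`.  By the witness half of the variational characterisation of
`σ_min` (`Literature.Analysis.Matrix.SigmaMinWitness.sigma_lower_le_div_of_witness`) EVERY rigorous σ-floor `f` of
`L − s·1` in the cell's predicate language (`∀ v, f‖v‖₂ ≤ ‖(L − s·1)v‖₂`) therefore satisfies `f ≤ |λ_a + λ_b − s|` for all
`1 ≤ a, b ≤ m` — the statement behind the certnum cell's EXACT ORACLE for the «lapshift» benchmark family
(`pub/certnum/certnum-ila-1/fixtures-032/lapshift_oracle.py`: a certified floor of `σ_min(lap2d(m) − s·1)` is compared with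
`min_{a,b} |λ_a + λ_b − s|`; this file proves the «floor ≤ oracle» direction, which is the soundness check the fixtures assert).

* `sigma_lower_le_abs_of_mulVec_eq_smul` — an eigen-relation `A v = c v`, `v ≠ 0`, pins the witnessed quotient to `|c|`,
  so every rigorous σ-floor is `≤ |c|` (private plumbing: the quotient identity and the shift `(A − s·1)v = (c − s)v`).
* `secondDifference_mulVec_sineMode` — `T e_k = (2 − 2cos(kπ/(m+1))) e_k` (via the three-term recurrence
  `Literature.Probability.LatticeModels.dstSin_rec` and the boundary zeros `dstSin_zero` / `dstSin_width` already in the tree).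
* `sineMode_ne_zero` — `e_k ≠ 0` for `1 ≤ k ≤ m`.
* `kroneckerSum_mulVec_tensor_of_mulVec_eq_smul` — `A u = α u`, `B w = β w` ⇒ `(A ⊕ B)(u ⊗ w) = (α + β)(u ⊗ w)`
  (from `KroneckerSum.kroneckerSum_mulVec_tensor`); private `tensor_ne_zero` — `u ⊗ w ≠ 0` from non-vanishing entries.
* `sigma_lower_shifted_kroneckerSum_le` — the oracle bound: `f ≤ |(2 − 2cos(aπ/(m+1))) + (2 − 2cos(bπ/(m+1))) − s|`.

The tridiagonal matrix is taken by HYPOTHESIS on its entries (`T i j = 2` on the diagonal, `−1` on the two off-diagonals,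
`0` elsewhere) — no new definition; modes are written with the tree's `dstSin m k X = sin(k X π/(m+1))` and
`dstAngle m k = kπ/(m+1)`.  Real matrices, Euclidean norm via `WithLp.toLp 2` as in the sibling files.  Everything here is
folklore / PROVED.  Deliberately NOT here: completeness of the modes (that these are ALL eigenvalues, i.e. the «oracle ≤
σ_min» direction, which needs the discrete sine orthogonality `sum_range_sin_mul_sin` plus a dimension count) and any
floating-point statement about the benchmark matrices (whose entries `2 − s`, `4 − s` are the rounded ones).
-/

open scoped Matrix

namespace Literature.Analysis.Matrix.DirichletLaplacianSineModes

open _root_.Matrix WithLp Literature.Probability.LatticeModels Literature.Analysis.Matrix.KroneckerSum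

/-! ## Eigen-relations pin the witnessed quotient -/

section Quotient

variable {n : Type*} [Fintype n]

/-- If `A v = c • v` then `‖Av‖₂ = |c| ‖v‖₂` (plumbing). [folklore] -/
private theorem norm_toLp_mulVec_of_mulVec_eq_smul {A : Matrix n n ℝ} {v : n → ℝ} {c : ℝ} (h : A *ᵥ v = c • v) :
    ‖toLp 2 (A *ᵥ v)‖ = |c| * ‖toLp 2 v‖ := by
  rw [h, toLp_smul, norm_smul, Real.norm_eq_abs]

/-- If `A v = c • v` with `v ≠ 0` then the witnessed quotient `‖Av‖₂/‖v‖₂` equals `|c|` (plumbing). [folklore] -/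
private theorem mulVec_eq_smul_norm_div {A : Matrix n n ℝ} {v : n → ℝ} {c : ℝ} (h : A *ᵥ v = c • v) (hv : v ≠ 0) :
    ‖toLp 2 (A *ᵥ v)‖ / ‖toLp 2 v‖ = |c| := by
  have hpos : 0 < ‖toLp 2 v‖ := by
    rw [norm_pos_iff, ne_eq, toLp_eq_zero]; exact hv
  rw [norm_toLp_mulVec_of_mulVec_eq_smul h, mul_div_assoc, div_self hpos.ne', mul_one]

/-- **An eigen-relation bounds every rigorous σ-floor.** If `A v = c • v`, `v ≠ 0`, and `f` is a σ-floor of `A` in the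
cell's predicate language (`∀ u, f‖u‖₂ ≤ ‖Au‖₂`), then `f ≤ |c|` — the witness half of `σ_min(A) = min_{x ≠ 0} ‖Ax‖₂/‖x‖₂`
(`SigmaMinWitness.sigma_lower_le_div_of_witness`) evaluated at an eigenvector, where the quotient is `|c|`.
[cite: Bernstein2009, Fact 9.13.1 (σ_min as the minimum of ‖Ax‖₂/‖x‖₂; taken at an eigenvector x = v)] -/
theorem sigma_lower_le_abs_of_mulVec_eq_smul {A : Matrix n n ℝ} {v : n → ℝ} {c f : ℝ} (h : A *ᵥ v = c • v)
    (hv : v ≠ 0) (hf : ∀ u : n → ℝ, f * ‖toLp 2 u‖ ≤ ‖toLp 2 (A *ᵥ u)‖) : f ≤ |c| := by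
  have := SigmaMinWitness.sigma_lower_le_div_of_witness hf hv
  rwa [mulVec_eq_smul_norm_div h hv] at this

variable [DecidableEq n]

/-- Shifting an eigen-relation: `A v = c • v` ⇒ `(A − s·1) v = (c − s) • v` (plumbing). [folklore] -/
private theorem sub_smul_one_mulVec_of_mulVec_eq_smul {A : Matrix n n ℝ} {v : n → ℝ} {c : ℝ} (h : A *ᵥ v = c • v) (s : ℝ) :
    (A - s • (1 : Matrix n n ℝ)) *ᵥ v = (c - s) • v := by
  rw [sub_mulVec, smul_mulVec, one_mulVec, h, sub_smul]

end Quotient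

/-! ## The sine modes of the second-difference matrix -/

section OneD

variable {m : ℕ}

/-- Plumbing: `∑_{j < m} [i+1 = j] w(j+1) = w(i+2)` for `i < m` when `w(m+1) = 0` (the super-diagonal neighbour, with the
right boundary zero absorbing the missing term). [folklore] -/
private theorem sum_ite_succ_eq (w : ℤ → ℝ) (hw : w ((m : ℤ) + 1) = 0) (i : Fin m) :
    (∑ j : Fin m, if (i : ℕ) + 1 = (j : ℕ) then w ((j : ℕ) + 1) else 0) = w ((i : ℕ) + 2) := by
  rw [Fin.sum_univ_eq_sum_range (fun j : ℕ => if (i : ℕ) + 1 = j then w ((j : ℕ) + 1) else 0) m,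
    Finset.sum_ite_eq]
  by_cases h : (i : ℕ) + 1 < m
  · rw [if_pos (Finset.mem_range.2 h)]; push_cast; ring_nf
  · have hm : (i : ℕ) + 1 = m := by omega
    rw [if_neg (by rw [Finset.mem_range]; exact h)]
    have : ((i : ℕ) : ℤ) + 2 = (m : ℤ) + 1 := by omega
    rw [this, hw]

/-- Plumbing: `∑_{j < m} [j+1 = i] w(j+1) = w(i)` for `i < m` when `w(0) = 0` (the sub-diagonal neighbour, with the left
boundary zero absorbing the missing term). [folklore] -/
private theorem sum_ite_pred_eq (w : ℤ → ℝ) (hw : w 0 = 0) (i : Fin m) :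
    (∑ j : Fin m, if (j : ℕ) + 1 = (i : ℕ) then w ((j : ℕ) + 1) else 0) = w (i : ℕ) := by
  rw [Fin.sum_univ_eq_sum_range (fun j : ℕ => if j + 1 = (i : ℕ) then w ((j : ℕ) + 1) else 0) m]
  rcases Nat.eq_zero_or_pos (i : ℕ) with h0 | hpos
  · rw [h0, Finset.sum_eq_zero (fun j _ => by rw [if_neg (by omega)])]; exact_mod_cast hw.symm
  · obtain ⟨p, hp⟩ : ∃ p, (i : ℕ) = p + 1 := ⟨(i : ℕ) - 1, by omega⟩
    have hpm : p < m := by have := i.isLt; omega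
    rw [hp]
    have : ∀ j ∈ Finset.range m, (if j + 1 = p + 1 then w ((j : ℕ) + 1) else 0) = (if p = j then w ((j : ℕ) + 1) else 0) := by
      intro j _
      by_cases hj : p = j
      · rw [if_pos (by omega), if_pos hj]
      · rw [if_neg (by omega), if_neg hj]
    rw [Finset.sum_congr rfl this, Finset.sum_ite_eq, if_pos (Finset.mem_range.2 hpm)]
    push_cast; ring_nf

/-- **The sine modes are eigenvectors of the second-difference matrix.** For the `m × m` matrix `T` with `2` on the
diagonal, `−1` on the two off-diagonals and `0` elsewhere, and ANY `k ∈ ℕ`, the vector `e_k(i) = sin(k(i+1)π/(m+1))`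
(`= dstSin m k (i+1)`) satisfies `T e_k = (2 − 2cos(kπ/(m+1))) e_k` — the three-term recurrence `dstSin_rec` inside, the
boundary zeros `e_k(0) = e_k(m+1) = 0` at the two ends. [cite: NoscheseReichel2019, §1 eq. (2)–(3) (δ = 2, σ = τ = −1)] -/
theorem secondDifference_mulVec_sineMode (T : Matrix (Fin m) (Fin m) ℝ)
    (hT : ∀ i j : Fin m, T i j = if i = j then 2 else if (i : ℕ) + 1 = (j : ℕ) ∨ (j : ℕ) + 1 = (i : ℕ) then -1 else 0)
    (k : ℕ) :
    T *ᵥ (fun i : Fin m => dstSin m k ((i : ℕ) + 1)) =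
      (2 - 2 * Real.cos (dstAngle m k)) • fun i : Fin m => dstSin m k ((i : ℕ) + 1) := by
  funext i
  simp only [mulVec, dotProduct, Pi.smul_apply, smul_eq_mul]
  -- split the tridiagonal row into its three indicator pieces
  have hsplit : ∀ j : Fin m, T i j * dstSin m k ((j : ℕ) + 1) =
      2 * (if i = j then dstSin m k ((j : ℕ) + 1) else 0) - (if (i : ℕ) + 1 = (j : ℕ) then dstSin m k ((j : ℕ) + 1) else 0)
        - (if (j : ℕ) + 1 = (i : ℕ) then dstSin m k ((j : ℕ) + 1) else 0) := by
    intro j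
    rw [hT i j]
    by_cases hij : i = j
    · have : (i : ℕ) = (j : ℕ) := congrArg Fin.val hij
      rw [if_pos hij, if_pos hij, if_neg (by omega), if_neg (by omega)]; ring
    · have : (i : ℕ) ≠ (j : ℕ) := fun h => hij (Fin.ext h)
      rw [if_neg hij, if_neg hij]
      by_cases h1 : (i : ℕ) + 1 = (j : ℕ)
      · rw [if_pos (Or.inl h1), if_pos h1, if_neg (by omega)]; ring
      · by_cases h2 : (j : ℕ) + 1 = (i : ℕ)
        · rw [if_pos (Or.inr h2), if_neg h1, if_pos h2]; ring
        · rw [if_neg (not_or.mpr ⟨h1, h2⟩), if_neg h1, if_neg h2]; ring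
  rw [Finset.sum_congr rfl fun j _ => hsplit j, Finset.sum_sub_distrib, Finset.sum_sub_distrib, ← Finset.mul_sum,
    Finset.sum_ite_eq, if_pos (Finset.mem_univ i)]
  -- the two neighbours, boundary zeros included
  have hS : (∑ j : Fin m, if (i : ℕ) + 1 = (j : ℕ) then dstSin m k ((j : ℕ) + 1) else 0) = dstSin m k ((i : ℕ) + 2) := by
    have := sum_ite_succ_eq (m := m) (fun X => dstSin m k X) (by exact_mod_cast (dstSin_width (L := m) (m := k))) i
    simpa using this
  have hP : (∑ j : Fin m, if (j : ℕ) + 1 = (i : ℕ) then dstSin m k ((j : ℕ) + 1) else 0) = dstSin m k (i : ℕ) := by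
    have := sum_ite_pred_eq (m := m) (fun X => dstSin m k X) (dstSin_zero (L := m) (m := k)) i
    simpa using this
  rw [hS, hP]
  have hrec := dstSin_rec (L := m) (m := k) (((i : ℕ) : ℤ) + 1)
  rw [show (((i : ℕ) : ℤ) + 1 + 1) = ((i : ℕ) : ℤ) + 2 by ring, show (((i : ℕ) : ℤ) + 1 - 1) = ((i : ℕ) : ℤ) by ring] at hrec
  linear_combination (-1 : ℝ) * hrec

/-- The first entry of a sine mode, `sin(kπ/(m+1))`, is positive for `1 ≤ k ≤ m` (plumbing). [folklore] -/
private theorem dstSin_one_pos {k : ℕ} (hk : 1 ≤ k) (hkm : k ≤ m) : 0 < dstSin m k 1 := by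
  unfold dstSin
  push_cast
  rw [one_mul]
  apply Real.sin_pos_of_pos_of_lt_pi
  · positivity
  · rw [mul_div_assoc', div_lt_iff₀ (by positivity : (0 : ℝ) < (m : ℝ) + 1)]
    have : (k : ℝ) ≤ m := by exact_mod_cast hkm
    nlinarith [Real.pi_pos]

/-- **The sine modes are non-zero** for `1 ≤ k ≤ m`: the first entry is `sin(kπ/(m+1)) > 0`, so `e_k` is a genuine
eigenvector. [cite: NoscheseReichel2019, §1 eq. (3) (the eigenvector x_h of T = (n; σ, δ, τ), here σ = τ = −1: first entry sin(hπ/(n+1)) ≠ 0 for 1 ≤ h ≤ n)] -/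
theorem sineMode_ne_zero {k : ℕ} (hk : 1 ≤ k) (hkm : k ≤ m) :
    (fun i : Fin m => dstSin m k ((i : ℕ) + 1)) ≠ 0 := by
  have hm : 0 < m := by omega
  intro h
  have h0 := congr_fun h ⟨0, hm⟩
  simp only [Pi.zero_apply, Nat.cast_zero, zero_add] at h0
  exact (dstSin_one_pos (m := m) hk hkm).ne' (by exact_mod_cast h0)

end OneD

/-! ## Separable modes of a Kronecker sum -/

section KroneckerSum

variable {m n : Type*} [Fintype m] [DecidableEq m] [Fintype n] [DecidableEq n]

/-- **Eigen-relations add under the Kronecker sum.** `A u = α u` and `B w = β w` give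
`(A ⊕ B)(u ⊗ w) = (α + β)(u ⊗ w)` for the separable vector `(u ⊗ w)(i,j) = u i · w j` — the eigenvector form of
`(A ⊕ B)(x ⊗ y) = (Ax) ⊗ y + x ⊗ (By)` (`KroneckerSum.kroneckerSum_mulVec_tensor`).
[cite: Bernstein2009, Def. 7.2.1 with Prop. 7.1.6 (7.1.12) (Kronecker sum acting on x ⊗ y; specialised to eigenvectors x, y)] -/
theorem kroneckerSum_mulVec_tensor_of_mulVec_eq_smul {A : Matrix m m ℝ} {B : Matrix n n ℝ} {u : m → ℝ} {w : n → ℝ}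
    {α β : ℝ} (hu : A *ᵥ u = α • u) (hw : B *ᵥ w = β • w) :
    kroneckerSum A B *ᵥ (fun p : m × n => u p.1 * w p.2) = (α + β) • fun p : m × n => u p.1 * w p.2 := by
  have h := kroneckerSum_mulVec_tensor A B u w
  rw [h, hu, hw]
  funext p
  simp only [Pi.smul_apply, smul_eq_mul]
  ring

omit [Fintype m] [DecidableEq m] [Fintype n] [DecidableEq n] in
/-- A separable vector with a non-vanishing entry in each factor is non-zero (plumbing). [folklore] -/
private theorem tensor_ne_zero {u : m → ℝ} {w : n → ℝ} {i : m} {j : n} (hu : u i ≠ 0) (hw : w j ≠ 0) :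
    (fun p : m × n => u p.1 * w p.2) ≠ 0 := by
  intro h
  have := congr_fun h (i, j)
  simp only [Pi.zero_apply, mul_eq_zero] at this
  exact this.elim hu hw

end KroneckerSum

/-! ## The oracle bound for the shifted 2-D Dirichlet Laplacian -/

section Oracle

variable {m : ℕ}

/-- **Every rigorous σ-floor of `lap2d(m) − s·1` is at most `|λ_a + λ_b − s|`.**  Let `T` be the `m × m` second-difference
matrix (entries by hypothesis), `L = T ⊕ T` its Kronecker sum (the five-point Dirichlet Laplacian on the `m × m` grid) and
`s` any real shift.  If `f` is a σ-floor of `L − s·1` in the cell's predicate language, then for all `1 ≤ a, b ≤ m`,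
`f ≤ |(2 − 2cos(aπ/(m+1))) + (2 − 2cos(bπ/(m+1))) − s|`; in particular `f ≤ min_{a,b} |λ_a + λ_b − s|`, the value the
certnum «lapshift» oracle computes.  Proof: the separable sine mode `e_a ⊗ e_b` is an eigenvector of `L − s·1` with that
eigenvalue (the 1-D eigenpairs `secondDifference_mulVec_sineMode` added under the Kronecker sum, Bernstein 2009 Def. 7.2.1),
and a σ-floor lies below every witnessed quotient (`SigmaMinWitness.sigma_lower_le_div_of_witness`, Bernstein 2009
Fact 9.13.1). [cite: NoscheseReichel2019, §1 eq. (2)–(3) (the tridiagonal-Toeplitz eigenpairs, δ = 2, σ = τ = −1, summed pairwise for the Kronecker sum and read as a bound on every σ-floor of the shifted matrix)] -/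
theorem sigma_lower_shifted_kroneckerSum_le (T : Matrix (Fin m) (Fin m) ℝ)
    (hT : ∀ i j : Fin m, T i j = if i = j then 2 else if (i : ℕ) + 1 = (j : ℕ) ∨ (j : ℕ) + 1 = (i : ℕ) then -1 else 0)
    (s f : ℝ)
    (hf : ∀ v : Fin m × Fin m → ℝ,
      f * ‖toLp 2 v‖ ≤ ‖toLp 2 ((kroneckerSum T T - s • (1 : Matrix (Fin m × Fin m) (Fin m × Fin m) ℝ)) *ᵥ v)‖)
    {a b : ℕ} (ha : 1 ≤ a) (ham : a ≤ m) (hb : 1 ≤ b) (hbm : b ≤ m) :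
    f ≤ |(2 - 2 * Real.cos (dstAngle m a)) + (2 - 2 * Real.cos (dstAngle m b)) - s| := by
  have hm : 0 < m := by omega
  have hea := secondDifference_mulVec_sineMode T hT a
  have heb := secondDifference_mulVec_sineMode T hT b
  have hL := kroneckerSum_mulVec_tensor_of_mulVec_eq_smul hea heb
  have hLs := sub_smul_one_mulVec_of_mulVec_eq_smul hL s
  -- the separable mode is non-zero: both first entries are `sin(kπ/(m+1)) > 0`
  have h1 : (fun i : Fin m => dstSin m a ((i : ℕ) + 1)) ⟨0, hm⟩ ≠ 0 := by
    simp only [Nat.cast_zero, zero_add]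
    exact_mod_cast (dstSin_one_pos (m := m) ha ham).ne'
  have h2 : (fun i : Fin m => dstSin m b ((i : ℕ) + 1)) ⟨0, hm⟩ ≠ 0 := by
    simp only [Nat.cast_zero, zero_add]
    exact_mod_cast (dstSin_one_pos (m := m) hb hbm).ne'
  have hne := tensor_ne_zero (u := fun i : Fin m => dstSin m a ((i : ℕ) + 1))
    (w := fun i : Fin m => dstSin m b ((i : ℕ) + 1)) h1 h2
  exact sigma_lower_le_abs_of_mulVec_eq_smul hLs hne hf

end Oracle

end Literature.Analysis.Matrix.DirichletLaplacianSineModes
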